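import Literature.Computability.FineGrained.LCSFromOVProgram
import Literature.Computability.FineGrained.SplitAndListOV
import HarnessLib

/-!
# OV → LCS on the word RAM, III: the bits written are `ovX I`, `ovY I`; the whole program and its run

**Part 1 (the bridge).** The Boolean position arithmetic of the reduction program
(`LCSRed.xBit₃`, `LCSRed.yBit₆` of `Literature.Computability.FineGrained.LCSFromOVProgram`) computes
the strings of Bringmann–Künnemann's reduction (`BKLCSReduction.ovX`, `BKLCSReduction.ovY` of
`Literature.Computability.FineGrained.LCSOVGadgets`): `LCSRed.xBit₃_eq` (`xBit₃ p = (ovX I)[p]`) and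
`LCSRed.yBit₆_eq` (`yBit₆ p = (ovY I)[p]`), level by level through
`BKLCS.Params.getD_gadgetX/getD_gadgetY` (`LCSOVBits`); and `LX = |ovX I|`, `LY = |ovY I|`.

**Part 2 (the run).** The complete reduction program of Bringmann–Künnemann's OV → LCS reduction (FOCS 2015, Thm. 3.3
with §4) on the word RAM with an LCS oracle (`WordRAM.Program` with one `query`), and its run on
the encoding of an OV instance `I`:

* `LCSRed.geo I`: the geometry of the run on `OV.encode I` (`D = |OV.encode I| + 100`);
* `LCSRed.prog` = `relocate; setup₁; if n = 0 then output [0] else main`,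
  `main = setupMain; loopX; loopY; query Q LEN ANS; post` — `post` reads the oracle's answer `L`
  and outputs `[LX + LY < ρ + 2L + 1]`, i.e. `[δ_LCS(x, y) ≤ ρ]`;
* `LCSRed.readSeg_dataQ`: the query is `encodeBoolPair (ovX I, ovY I) = LCS.encode (ovX I, ovY I)`;
* `LCSRed.rho_eq`: the program's threshold is `ovThreshold I`;
* **`LCSRed.prog_exec`**: for every oracle answering `LCS`, `prog` executes on `OV.encode I` within
  `LCSRed.Ttot I` steps to a store with read-out `[1]` iff `I` has an orthogonal pair (`[0]`
  otherwise) and query log `[LCS.encode (ovX I, ovY I)]` (empty if `n = 0`), provided the word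
  size holds the input width and `(geo I).BND`.
-/

namespace Literature.Computability.FineGrained.LCSRed

open Cryptography Cryptography.WordRAM BKGadget BKLCS BKLCSReduction

/-! ### `blockBit` versus `sixBit` -/

/-- The bits of a period (`blockBit`) are the six-way dispatch of the program (`sixBit`), for any
inner bit function agreeing with the block on its range. [folklore] -/
theorem blockBit_eq_sixBit (P : BKLCS.Params) (ℓ : ℕ) (z : List Bool) (zb : ℕ → Bool)
    (h : ∀ q, q < ℓ → z.getD q false = zb q) (r : ℕ) :
    P.blockBit ℓ z r =
      sixBit P.γ₂ (P.γ₂ + P.γ₁) (P.γ₂ + P.γ₁ + ℓ) (P.γ₂ + P.γ₁ + ℓ + P.γ₁) (P.γ₂ + P.γ₁ + ℓ + P.γ₁ + P.γ₂)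
        zb r := by
  unfold BKLCS.Params.blockBit sixBit
  by_cases h1 : r < P.γ₂
  · rw [if_pos h1, if_pos h1]
  rw [if_neg h1, if_neg h1]
  by_cases h2 : r < P.γ₂ + P.γ₁
  · rw [if_pos h2, if_pos h2]
  rw [if_neg h2, if_neg h2]
  by_cases h3 : r < P.γ₂ + P.γ₁ + ℓ
  · rw [if_pos h3, if_pos h3]; exact h _ (by omega)
  rw [if_neg h3, if_neg h3]

/-- The level-1 instance: the period of a coordinate word. [folklore] -/
theorem blockBit_P₁ (w : List Bool) (zb : ℕ → Bool) (h : ∀ t, t < 5 → w.getD t false = zb t) (r : ℕ) :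
    P₁.blockBit 5 w r = sixBit 60 70 75 85 145 zb r :=
  blockBit_eq_sixBit P₁ 5 w zb h r

/-! ### Coordinate words -/

/-- Bits of `CG(a, k)` / `S`'s coordinate (the `x` side) are `xBit`. [cite: BringmannKunnemannFOCS2015, Lemma 4.1] -/
theorem getD_xCoord (I : OVInstance) (hn : 0 < I.n) (i₃ sel k : ℕ) (hk : k < I.d + 1) (hsel : sel ≤ 1)
    (t : ℕ) (ht : t < 5) :
    ((if sel = 1 then cgX (I.A ⟨i₃ % I.n, Nat.mod_lt _ hn⟩) ⟨k, hk⟩ else cgS I.d ⟨k, hk⟩).getD t false) =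
      xBit (decide (sel = 1)) (decide (k < I.d)) (aBit I hn i₃ k) t := by
  unfold xBit aBit BKReduction.cgX BKReduction.cgS
  rcases Nat.le_one_iff_eq_zero_or_eq_one.1 hsel with rfl | rfl
  · simp only [zero_ne_one, if_false, decide_false, Bool.and_false, Bool.false_or, Bool.or_false]
    by_cases hkd : k < I.d
    · simp only [hkd, if_true, decide_true, Bool.not_true, Bool.false_and, Bool.false_or,
        Bool.not_false, Bool.true_and]
      interval_cases t <;> rfl
    · simp only [hkd, if_false, decide_false, Bool.not_false, Bool.true_and, Bool.not_true,
        Bool.false_and, Bool.or_false]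
      interval_cases t <;> rfl
  · simp only [if_true, decide_true, Bool.and_true, Bool.or_true, Bool.not_true, Bool.or_false]
    by_cases hkd : k < I.d
    · simp only [hkd, dif_pos, decide_true, Bool.true_and]
      cases I.A ⟨i₃ % I.n, Nat.mod_lt _ hn⟩ ⟨k, hkd⟩ <;> (interval_cases t <;> rfl)
    · simp only [hkd, dif_neg, not_false_eq_true, decide_false, Bool.false_and, Bool.not_false,
        Bool.true_and]
      interval_cases t <;> rfl

/-- Bits of `CG(b, k)` (the `y` side) are `yBit`. [cite: BringmannKunnemannFOCS2015, Lemma 4.1] -/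
theorem getD_yCoord (I : OVInstance) (j : Fin I.n) (k : ℕ) (hk : k < I.d + 1) (t : ℕ) (ht : t < 5) :
    (cgY (I.B j) ⟨k, hk⟩).getD t false = yBit (decide (k < I.d)) (bBit I j k) t := by
  unfold yBit bBit BKReduction.cgY
  by_cases hkd : k < I.d
  · simp only [hkd, dif_pos, decide_true, Bool.true_and, j.isLt, and_self, Bool.not_true,
      Bool.or_false]
    have : (⟨j, j.isLt⟩ : Fin I.n) = j := rfl
    rw [this]
    cases I.B j ⟨k, hkd⟩ <;> (interval_cases t <;> rfl)
  · simp only [hkd, dif_neg, not_false_eq_true, decide_false, Bool.false_and, Bool.not_false,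
      Bool.or_true, Bool.true_and, Bool.not_true, and_false]
    interval_cases t <;> rfl

/-! ### The `x` side -/

section bridge

variable (g : Geo) (I : OVInstance) (hg : g.n = I.n ∧ g.d = I.d)
include hg

/-- Bits of a level-1 string `P₁.gadgetX (CG₀, …, CG_d)` by coordinate and bit index. [folklore] -/
theorem getD_gadgetX_P₁ (cg : Fin (I.d + 1) → List Bool) (hcg : ∀ k, (cg k).length = 5) (q : ℕ)
    (hq : q < g.q₂.ℓx) :
    (P₁.gadgetX (List.ofFn cg)).getD q false =
      P₁.blockBit 5 (cg ⟨q / 246, (Nat.div_lt_iff_lt_mul (by decide)).2 (by rw [g.q₂_ℓx, hg.2] at hq; omega)⟩)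
        (q % 246) := by
  have hℓ : g.q₂.ℓx = I.d * 246 + 145 := by rw [g.q₂_ℓx, hg.2]
  have hkd : q / 246 < I.d + 1 := (Nat.div_lt_iff_lt_mul (by decide)).2 (by omega)
  have hlen : (P₁.gadgetX (List.ofFn cg)).length = (I.d + 1) * 145 + I.d * 101 := by
    rw [P₁.length_gadgetX (ℓ := 5) _ (by simp [List.mem_ofFn', hcg]), List.length_ofFn, P₁_γ₂, P₁_γ₁, P₁_γ₃]
    simp
  rw [P₁.getD_gadgetX (ℓ := 5) (by decide) _ (by simp [List.mem_ofFn', hcg]) q (by rw [hlen]; omega), P₁_perOf,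
    List.getD_eq_getElem _ _ (by simpa using hkd), List.getElem_ofFn]

/-- Level 1 (`x` side): bits of `VG(a_{i₃ mod n})` (`sel = 1`) / `S` (`sel = 0`) are `xBit₁`. [folklore] -/
theorem getD_vg_eq_xBit₁ (hn : 0 < I.n) (i₃ sel : ℕ) (hsel : sel ≤ 1) (q : ℕ) (hq : q < g.q₂.ℓx) :
    ((if sel = 1 then vgX (I.A ⟨i₃ % I.n, Nat.mod_lt _ hn⟩) else vgS I.d).getD q false) =
      xBit₁ I hn i₃ sel q := by
  have hkd : q / 246 < I.d + 1 := (Nat.div_lt_iff_lt_mul (by decide)).2 (by rw [g.q₂_ℓx, hg.2] at hq; omega)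
  unfold xBit₁
  rcases Nat.le_one_iff_eq_zero_or_eq_one.1 hsel with rfl | rfl
  · rw [if_neg zero_ne_one]
    unfold vgS
    rw [getD_gadgetX_P₁ g I hg (cgS I.d) (length_cgS I.d) q hq]
    exact blockBit_P₁ _ _ (fun t ht => by
      simpa using getD_xCoord I hn i₃ 0 (q / 246) hkd (by decide) t ht) _
  · rw [if_pos rfl]
    unfold vgX
    rw [getD_gadgetX_P₁ g I hg (cgX _) (length_cgX _) q hq]
    exact blockBit_P₁ _ _ (fun t ht => by
      simpa using getD_xCoord I hn i₃ 1 (q / 246) hkd le_rfl t ht) _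

omit hg in
/-- The level-2 period in the program's form. [folklore] -/
theorem per₂_eq : g.q₂.γ₂ + g.q₂.γ₁ + g.q₂.ℓx + g.q₂.γ₁ + g.q₂.γ₂ + g.q₂.γ₃ = g.q₂.perOf g.q₂.ℓx := by
  unfold BKLCS.Params.perOf; omega

/-- Level 2 (`x` side): bits of `NVG(a_{i₃ mod n})` are `xBit₂`. [folklore] -/
theorem getD_nvgX_eq_xBit₂ (hn : 0 < I.n) (i₃ q : ℕ) (hq : q < g.q₃.ℓx) :
    (nvgX (I.A ⟨i₃ % I.n, Nat.mod_lt _ hn⟩)).getD q false = xBit₂ g I hn i₃ q := by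
  obtain ⟨hgn, hgd⟩ := hg
  have hq₂ : g.q₂ = P₂ I.d := by rw [Geo.q₂, hgd]
  have hℓ₃ : g.q₃.ℓx = g.q₂.perOf g.q₂.ℓx + (2 * g.q₂.γ₂ + 2 * g.q₂.γ₁ + g.q₂.ℓx) := by
    rw [g.q₃_ℓx]; unfold BKLCS.Params.perOf; omega
  have hpos : 0 < g.q₂.ℓx := by rw [g.q₂_ℓx]; omega
  have hper0 : 0 < g.q₂.perOf g.q₂.ℓx := by unfold BKLCS.Params.perOf; omega
  have hper_ge : 2 * g.q₂.γ₂ + 2 * g.q₂.γ₁ + g.q₂.ℓx ≤ g.q₂.perOf g.q₂.ℓx := by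
    unfold BKLCS.Params.perOf; omega
  have hsel : q / g.q₂.perOf g.q₂.ℓx ≤ 1 := by
    have : q / g.q₂.perOf g.q₂.ℓx < 2 := (Nat.div_lt_iff_lt_mul hper0).2 (by omega)
    omega
  unfold xBit₂
  rw [per₂_eq g]
  unfold nvgX
  rw [ofFn_pairSX, ← hq₂]
  have hlen2 : ∀ z ∈ [vgS I.d, vgX (I.A ⟨i₃ % I.n, Nat.mod_lt _ hn⟩)], z.length = g.q₂.ℓx := by
    intro z hz
    simp only [List.mem_cons, List.not_mem_nil, or_false] at hz
    rcases hz with rfl | rfl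
    · rw [length_vgS, hq₂]; rfl
    · rw [length_vgX, hq₂]; rfl
  have hlenN : (g.q₂.gadgetX [vgS I.d, vgX (I.A ⟨i₃ % I.n, Nat.mod_lt _ hn⟩)]).length = g.q₃.ℓx := by
    rw [g.q₂.length_gadgetX _ hlen2, g.q₃_ℓx]; simp
  rw [g.q₂.getD_gadgetX hpos _ hlen2 q (by rw [hlenN]; exact hq)]
  refine blockBit_eq_sixBit _ _ _ _ (fun q' hq' => ?_) _
  rcases Nat.le_one_iff_eq_zero_or_eq_one.1 hsel with h0 | h1
  · rw [h0]
    simpa using getD_vg_eq_xBit₁ g I ⟨hgn, hgd⟩ hn i₃ 0 (by decide) q' hq'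
  · rw [h1]
    simpa using getD_vg_eq_xBit₁ g I ⟨hgn, hgd⟩ hn i₃ 1 le_rfl q' hq'

omit hg in
/-- The level-3 period in the program's form. [folklore] -/
theorem per₃_eq : g.G₃ + g.q₃.γ₃ = g.q₃.perOf g.q₃.ℓx := by
  unfold Geo.G₃ BKLCS.Params.perOf; omega

/-- `|ovX I| = LX`. [folklore] -/
theorem length_ovX_eq (hn : 0 < I.n) : (ovX I).length = g.LX := by
  rw [length_ovX]
  unfold Geo.LX Geo.G₃
  rw [Geo.q₃, hg.1, hg.2]
  have : 1 ≤ 2 * I.n := by omega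
  zify [this, show 1 ≤ I.n + I.n by omega]
  ring

/-- **Level 3 (`x` side): the `x` loop writes the bits of `ovX I`.** [folklore] -/
theorem xBit₃_eq (hn : 0 < I.n) (p : ℕ) (hp : p < (ovX I).length) :
    xBit₃ g I hn p = (ovX I).getD p false := by
  obtain ⟨hgn, hgd⟩ := hg
  have hq₃ : g.q₃ = P₃ I.d := by rw [Geo.q₃, hgd]
  have hpos : 0 < g.q₃.ℓx := by
    rw [g.q₃_ℓx, g.q₂_γ₂, g.q₂_γ₁, g.q₂_ℓx]; omega
  have hper0 : 0 < g.q₃.perOf g.q₃.ℓx := by unfold BKLCS.Params.perOf; omega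
  have hlen3 : ∀ z ∈ List.ofFn (xs I), z.length = g.q₃.ℓx := by
    intro z hz
    obtain ⟨i, rfl⟩ := (List.mem_ofFn' _ _).1 hz
    unfold xs; rw [length_nvgX, hq₃]; rfl
  have hLX := length_ovX_eq g I ⟨hgn, hgd⟩ hn
  have hi : p / g.q₃.perOf g.q₃.ℓx < 2 * I.n := by
    refine (Nat.div_lt_iff_lt_mul hper0).2 ?_
    have h := g.q₃.length_gadgetX_add (zs := List.ofFn (xs I)) (by simp; omega)
      (by intro z hz; rw [hlen3 z hz, hq₃])
    rw [List.length_ofFn] at h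
    have : (g.q₃.gadgetX (List.ofFn (xs I))).length = (ovX I).length := by unfold ovX; rw [hq₃]
    rw [this, ← g.q₃.perOf_ℓx] at h
    nlinarith [hp, h, hper0]
  unfold xBit₃
  rw [per₃_eq g]
  symm
  unfold ovX
  rw [← hq₃, g.q₃.getD_gadgetX hpos _ hlen3 p (by unfold ovX at hp; rwa [← hq₃] at hp),
    List.getD_eq_getElem _ _ (by simpa using hi), List.getElem_ofFn]
  unfold xs
  exact blockBit_eq_sixBit _ _ _ _ (fun q hq => getD_nvgX_eq_xBit₂ g I ⟨hgn, hgd⟩ hn _ q hq) _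

/-! ### The `y` side -/

/-- Level 1 (`y` side): bits of the core of `VG(b_j)` are `yBit₁`. [folklore] -/
theorem getD_coreY_eq_yBit₁ (j : Fin I.n) (q : ℕ) (hq : q < g.q₂.ℓx) :
    (P₁.gadgetX (List.ofFn (cgY (I.B j)))).getD q false = yBit₁ I j q := by
  have hkd : q / 246 < I.d + 1 := (Nat.div_lt_iff_lt_mul (by decide)).2 (by rw [g.q₂_ℓx, hg.2] at hq; omega)
  unfold yBit₁
  rw [getD_gadgetX_P₁ g I hg (cgY _) (length_cgY _) q hq]
  exact blockBit_P₁ _ _ (fun t ht => getD_yCoord I j (q / 246) hkd t ht) _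

/-- Level 2 (`y` side): bits of `VG(b_j) = 0^{130(d+1)} core 0^{130(d+1)}` are `yBit₂`. [folklore] -/
theorem getD_vgY_eq_yBit₂ (j : Fin I.n) (q : ℕ) : (vgY (I.B j)).getD q false = yBit₂ g I j q := by
  have hlen : (P₁.gadgetX (List.ofFn (cgY (I.B j)))).length = g.q₂.ℓx := by
    rw [P₁.length_gadgetX (ℓ := 5) _ (by simp [List.mem_ofFn', length_cgY]), List.length_ofFn, P₁_γ₂, P₁_γ₁,
      P₁_γ₃, g.q₂_ℓx, hg.2, Nat.add_sub_cancel]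
    ring
  unfold vgY yBit₂ threeBit
  rw [P₁.getD_gadgetY, P₁_γ₄, hlen, hg.2]
  have e : (I.d + 1) * 130 = I.d * 130 + 130 := by ring
  rw [e]
  by_cases h1 : q < I.d * 130 + 130
  · rw [if_pos h1, if_pos h1]
  rw [if_neg h1, if_neg h1]
  by_cases h2 : q - (I.d * 130 + 130) < g.q₂.ℓx
  · rw [if_pos h2, if_pos (by omega), getD_coreY_eq_yBit₁ g I hg j _ h2]
  · rw [if_neg h2, if_neg (by omega)]

/-- Level 3 (`y` side): bits of `G'(VG(b_j))` are `yBit₃`. [folklore] -/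
theorem getD_guard_vgY_eq_yBit₃ (j : Fin I.n) (q : ℕ) (hq : q < (g.q₂.guard (vgY (I.B j))).length) :
    (g.q₂.guard (vgY (I.B j))).getD q false = yBit₃ g I j q := by
  have hq₂ : g.q₂ = P₂ I.d := by rw [Geo.q₂, hg.2]
  have hz : (vgY (I.B j)).length = g.q₂.ℓy := by rw [length_vgY, hq₂]; rfl
  unfold yBit₃
  rw [g.q₂.getD_guard hz hq]
  exact blockBit_eq_sixBit _ _ _ _ (fun q' _ => getD_vgY_eq_yBit₂ g I hg j q') _

/-- Level 4 (`y` side): bits of `NVG(b_j) = 0^{2γ₄'} G'(VG(b_j)) 0^{2γ₄'}` are `yBit₄`. [folklore] -/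
theorem getD_nvgY_eq_yBit₄ (j : Fin I.n) (q : ℕ) : (nvgY (I.B j)).getD q false = yBit₄ g I j q := by
  have hq₂ : g.q₂ = P₂ I.d := by rw [Geo.q₂, hg.2]
  have hz : (vgY (I.B j)).length = g.q₂.ℓy := by rw [length_vgY, hq₂]; rfl
  have hG : (g.q₂.gadgetX [vgY (I.B j)]).length = g.q₂.γ₂ + g.q₂.γ₁ + g.q₂.ℓy + g.q₂.γ₁ + g.q₂.γ₂ := by
    simp only [BKLCS.Params.gadgetX, BKLCS.Params.length_guard, hz]; omega
  unfold nvgY yBit₄ threeBit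
  rw [ofFn_singleY, ← hq₂, g.q₂.getD_gadgetY, hG]
  have e : 2 * g.q₂.γ₄ = g.q₂.γ₄ + g.q₂.γ₄ := by ring
  rw [e]
  by_cases h1 : q < g.q₂.γ₄ + g.q₂.γ₄
  · rw [if_pos h1, if_pos h1]
  rw [if_neg h1, if_neg h1]
  by_cases h2 : q - (g.q₂.γ₄ + g.q₂.γ₄) < g.q₂.γ₂ + g.q₂.γ₁ + g.q₂.ℓy + g.q₂.γ₁ + g.q₂.γ₂
  · rw [if_pos h2, if_pos (by omega)]
    simp only [BKLCS.Params.gadgetX]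
    exact getD_guard_vgY_eq_yBit₃ g I hg j _ (by rw [BKLCS.Params.length_guard, hz]; omega)
  · rw [if_neg h2, if_neg (by omega)]

omit hg in
/-- The level-3 period of the core of `y` in the program's form. [folklore] -/
theorem per₃y_eq : g.G₃y + g.q₃.γ₃ = g.q₃.perOf g.q₃.ℓy := by
  unfold Geo.G₃y BKLCS.Params.perOf; omega

/-- The core of `y` has length `LC`. [folklore] -/
theorem length_coreY_eq : (g.q₃.gadgetX (List.ofFn (ys I))).length = g.LC := by
  have hq₃ : g.q₃ = P₃ I.d := by rw [Geo.q₃, hg.2]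
  have hlen3 : ∀ z ∈ List.ofFn (ys I), z.length = g.q₃.ℓy := by
    intro z hz
    obtain ⟨j, rfl⟩ := (List.mem_ofFn' _ _).1 hz
    unfold ys; rw [length_nvgY, hq₃]; rfl
  rw [g.q₃.length_gadgetX _ hlen3, List.length_ofFn]
  unfold Geo.LC Geo.G₃y
  rw [hg.1]
  have : I.n * (2 * g.q₃.γ₂ + 2 * g.q₃.γ₁ + g.q₃.ℓy) = I.n * (g.q₃.γ₂ + g.q₃.γ₁ + g.q₃.ℓy + g.q₃.γ₁ + g.q₃.γ₂) := by
    ring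
  omega

/-- `|ovY I| = LY`. [folklore] -/
theorem length_ovY_eq : (ovY I).length = g.LY := by
  have hq₃ : g.q₃ = P₃ I.d := by rw [Geo.q₃, hg.2]
  unfold ovY
  rw [← hq₃, g.q₃.length_gadgetY, length_coreY_eq g I hg]
  unfold Geo.LY Geo.NP
  rw [hg.1]; ring

/-- Level 5 (`y` side): bits of the core of `y` are `yBit₅`. [folklore] -/
theorem getD_coreY_eq_yBit₅ (hn : 0 < I.n) (q : ℕ) (hq : q < g.LC) :
    (g.q₃.gadgetX (List.ofFn (ys I))).getD q false = yBit₅ g I q := by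
  have hq₃ : g.q₃ = P₃ I.d := by rw [Geo.q₃, hg.2]
  have hlen3 : ∀ z ∈ List.ofFn (ys I), z.length = g.q₃.ℓy := by
    intro z hz
    obtain ⟨j, rfl⟩ := (List.mem_ofFn' _ _).1 hz
    unfold ys; rw [length_nvgY, hq₃]; rfl
  have hpos : 0 < g.q₃.ℓy := by
    rw [g.q₃_ℓy, g.q₂_γ₂, g.q₂_ℓy, g.q₂_ℓx]; omega
  have hper0 : 0 < g.q₃.perOf g.q₃.ℓy := by unfold BKLCS.Params.perOf; omega
  have hLC := length_coreY_eq g I hg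
  have hj : q / g.q₃.perOf g.q₃.ℓy < I.n := by
    refine (Nat.div_lt_iff_lt_mul hper0).2 ?_
    rw [← hg.1]
    have hn' : 1 ≤ g.n := by rw [hg.1]; exact hn
    have e1 : g.n * g.q₃.perOf g.q₃.ℓy = g.LC + g.q₃.γ₃ := by
      unfold Geo.LC Geo.G₃y BKLCS.Params.perOf
      obtain ⟨k, hk⟩ : ∃ k, g.n = k + 1 := ⟨g.n - 1, by omega⟩
      rw [hk, Nat.add_sub_cancel]; ring
    rw [e1]; omega
  unfold yBit₅
  rw [per₃y_eq g, g.q₃.getD_gadgetX hpos _ hlen3 q (by rw [hLC]; exact hq),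
    List.getD_eq_getElem _ _ (by simpa using hj), List.getElem_ofFn]
  unfold ys
  exact blockBit_eq_sixBit _ _ _ _ (fun q' _ => getD_nvgY_eq_yBit₄ g I hg _ q') _

/-- **Level 6 (`y` side): the `y` loop writes the bits of `ovY I`.** [folklore] -/
theorem yBit₆_eq (hn : 0 < I.n) (p : ℕ) : yBit₆ g I p = (ovY I).getD p false := by
  have hq₃ : g.q₃ = P₃ I.d := by rw [Geo.q₃, hg.2]
  have hNP : 2 * I.n * g.q₃.γ₄ = g.NP := by unfold Geo.NP; rw [hg.1]; ring
  have hLC := length_coreY_eq g I hg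
  unfold yBit₆ threeBit ovY
  rw [← hq₃, g.q₃.getD_gadgetY, hNP, hLC]
  by_cases h1 : p < g.NP
  · rw [if_pos h1, if_pos h1]
  rw [if_neg h1, if_neg h1]
  by_cases h2 : p - g.NP < g.LC
  · rw [if_pos h2, if_pos (by omega), getD_coreY_eq_yBit₅ g I hg hn _ h2]
  · rw [if_neg h2, if_neg (by omega)]

end bridge

end Literature.Computability.FineGrained.LCSRed

namespace Literature.Computability.FineGrained.LCSRed

open Cryptography Cryptography.WordRAM Cryptography.WordRAM.SProg BKGadget BKLCS BKLCSReduction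

/-! ### The geometry of an instance -/

/-- The geometry of the run on `OV.encode I`. [folklore] -/
noncomputable def geo (I : OVInstance) : Geo := ⟨I.n, I.d, (OV.encode I).length + 100⟩

/-- `geo I` has the right `n`, `d`. [folklore] -/
theorem geo_nd (I : OVInstance) : (geo I).n = I.n ∧ (geo I).d = I.d := ⟨rfl, rfl⟩

/-- `L = |OV.encode I| = 2 + 2 n d`. [folklore] -/
theorem geo_L (I : OVInstance) : (geo I).L = 2 + 2 * (I.n * I.d) := by
  show (OV.encode I).length + 100 - 100 = _
  rw [length_OV_encode]; omega

/-- `D = |OV.encode I| + 100 ≥ 100`. [folklore] -/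
theorem geo_D (I : OVInstance) : (geo I).D = 2 + 2 * (I.n * I.d) + 100 := by
  show (OV.encode I).length + 100 = _
  rw [length_OV_encode]

/-! ### The program -/

/-- Output `[0]` (the branch `n = 0`: no vectors, no orthogonal pair). [folklore] -/
def out0 : List OpSpec := [(.add, r 1, im 0, im 0), (.add, r 0, im 1, im 0)]

/-- The read-out after the query: `L := mem[ANS + 1]`; output `[LX + LY < ρ + 2L + 1]`, i.e.
`[δ_LCS(x,y) ≤ ρ]` (BK15, end of the proof of Thm. 3.3: "`δ(x,y) ≤ ρ` if and only if there is a
pair with `⟨aᵢ, bⱼ⟩ = 0`"). [cite: BringmannKunnemannFOCS2015, Thm. 3.3 (proof, the threshold)] -/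
def post : List OpSpec :=
  [(.add, r 20, r 74, im 1), (.add, r 21, pt 20, im 0), (.add, r 22, r 70, r 71),
   (.add, r 23, r 80, r 21), (.add, r 23, r 23, r 21), (.add, r 23, r 23, im 1),
   (.lt, r 1, r 22, r 23), (.add, r 0, im 1, im 0)]

/-- The main branch: set-up, the two loops, the query, the read-out. [folklore] -/
def main : SProg := seqs [setupMain, loopX, loopY, SProg.query (r 72) (r 73) (r 74), block post]

/-- **The reduction program** (structured): relocate the input, read `n, d`, branch on `n = 0`.
[cite: BringmannKunnemannFOCS2015, Thm. 3.3 (proof: "x and y … can be constructed in time O((n+m)d)")] -/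
def prog : SProg := seq relocate (seq (block setup₁) (ifz (r 10) (block out0) main))

/-- **The reduction program** as a word-RAM oracle program. [folklore] -/
def M : Program := prog.toProgram

/-- The reduction program is deterministic. [folklore] -/
theorem M_isDeterministic : M.IsDeterministic := toProgram_isDeterministic _

/-- The total running time: relocation, set-up, the two loops, the query and the read-out. [folklore] -/
noncomputable def Ttot (I : OVInstance) : ℕ :=
  7 * (2 + 2 * (I.n * I.d)) + (12 + (2 + (89 + ((geo I).LX * 68 + 1 + (2 + ((geo I).LY * 85 + 1) + (1 + 8)))))) + 2

/-! ### The threshold of the program is `ovThreshold I` -/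

/-- `ρ` computed by the set-up is BK15's threshold `C'' + (n-1) ρ₁' + ρ₀'`. [folklore] -/
theorem rho_eq (I : OVInstance) : (geo I).rho = ovThreshold I := by
  simp only [Geo.rho, Geo.NP, Geo.rho₀, Geo.rho₁, Geo.C₂, Geo.C₁, ovThreshold, C₃, ρ₀', ρ₁',
    BKLCSReduction.C₂, BKLCSReduction.C₁, BKLCS.Params.C, Geo.q₂, Geo.q₃, geo]
  rw [show P₁.γ₄ = 130 from rfl]
  ring

/-! ### The data after the loops, and the query segment -/

section data

variable (I : OVInstance) (hn : 0 < I.n)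

/-- The data memory at the time of the query: the relocated input, the header word `LX` at `Q`,
the bits of `ovX I` and `ovY I` after it. [folklore] -/
noncomputable def dataQ : ℕ → ℕ :=
  yData (geo I) I (xData (geo I) I hn (Function.update (relocated (OV.encode I)) (geo I).Q (geo I).LX)
    (geo I).LX) (geo I).LY

/-- **The query segment is `encodeBoolPair (ovX I, ovY I)`.** [folklore] -/
theorem readSeg_dataQ : readSeg (dataQ I hn) (geo I).Q (geo I).LEN = encodeBoolPair (ovX I, ovY I) := by
  have hLX := length_ovX_eq (geo I) I (geo_nd I) hn
  have hLY := length_ovY_eq (geo I) I (geo_nd I)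
  apply readSeg_eq_of_forall (by simp [encodeBoolPair, Geo.LEN, hLX, hLY])
  intro j hj
  unfold Geo.LEN at hj
  simp only [encodeBoolPair]
  rcases Nat.eq_zero_or_pos j with rfl | hjpos
  · -- the header word
    simp only [Nat.add_zero, List.getElem_cons_zero, hLX]
    unfold dataQ yData xData
    rw [if_neg (by omega), if_neg (by omega), Function.update_self]
  · obtain ⟨p, rfl⟩ : ∃ p, j = p + 1 := ⟨j - 1, by omega⟩
    rw [List.getElem_cons_succ, List.getElem_map]
    unfold dataQ yData xData
    by_cases hpx : p < (geo I).LX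
    · -- a bit of `ovX I`
      rw [if_neg (by omega), if_pos ⟨by omega, by omega⟩,
        show (geo I).Q + (p + 1) - ((geo I).Q + 1) = p by omega, xBit₃_eq (geo I) I (geo_nd I) hn p (by omega),
        List.getD_eq_getElem _ _ (by omega), List.getElem_append_left (by omega)]
    · -- a bit of `ovY I`
      rw [if_pos ⟨by omega, by omega⟩, show (geo I).Q + (p + 1) - ((geo I).Q + 1 + (geo I).LX) = p - (geo I).LX by omega,
        yBit₆_eq (geo I) I (geo_nd I) hn, List.getD_eq_getElem _ _ (by omega),
        List.getElem_append_right (by omega)]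
      simp only [hLX]

end data

/-! ### The input bits in the relocated memory -/

section run

variable {W : ℕ} {O : List ℕ → List ℕ} (I : OVInstance)

/-- The bits of `A` in the relocated input. [folklore] -/
theorem relocated_A (i : Fin I.n) (k : Fin I.d) :
    relocated (OV.encode I) ((i : ℕ) * I.d + k + ((geo I).D + 3)) = (I.A i k).toNat := by
  have hlen := length_OV_encode I
  have hik : (i : ℕ) * I.d + k < I.n * I.d :=
    calc (i : ℕ) * I.d + k < i * I.d + I.d := by omega
      _ = (i + 1) * I.d := by ring
      _ ≤ I.n * I.d := Nat.mul_le_mul_right _ i.2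
  rw [show (i : ℕ) * I.d + k + ((geo I).D + 3) = (OV.encode I).length + 100 + (3 + ((i : ℕ) * I.d + k)) by
      rw [geo_D, hlen]; omega,
    relocated_base_add _ (by omega) (by rw [hlen]; omega),
    show 3 + ((i : ℕ) * I.d + k) - 1 = 2 + ((i : ℕ) * I.d + k) by omega, List.getD_eq_getElem?_getD,
    OV_encode_getElem?_A]
  rfl

/-- The bits of `B` in the relocated input. [folklore] -/
theorem relocated_B (j : Fin I.n) (k : Fin I.d) :
    relocated (OV.encode I) ((j : ℕ) * I.d + k + ((geo I).D + 3 + I.n * I.d)) = (I.B j k).toNat := by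
  have hlen := length_OV_encode I
  have hjk : (j : ℕ) * I.d + k < I.n * I.d :=
    calc (j : ℕ) * I.d + k < j * I.d + I.d := by omega
      _ = (j + 1) * I.d := by ring
      _ ≤ I.n * I.d := Nat.mul_le_mul_right _ j.2
  rw [show (j : ℕ) * I.d + k + ((geo I).D + 3 + I.n * I.d) =
      (OV.encode I).length + 100 + (3 + (I.n * I.d + ((j : ℕ) * I.d + k))) by rw [geo_D, hlen]; omega,
    relocated_base_add _ (by omega) (by rw [hlen]; omega),
    show 3 + (I.n * I.d + ((j : ℕ) * I.d + k)) - 1 = 2 + (I.n * I.d + ((j : ℕ) * I.d + k)) by omega,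
    List.getD_eq_getElem?_getD, OV_encode_getElem?_B]
  rfl

/-- `A` is in place for the `x` loop. [folklore] -/
theorem inputA_start :
    InputA (geo I) I (Function.update (relocated (OV.encode I)) (geo I).Q (geo I).LX) := by
  intro i k
  have hik : (i : ℕ) * I.d + k < I.n * I.d :=
    calc (i : ℕ) * I.d + k < i * I.d + I.d := by omega
      _ = (i + 1) * I.d := by ring
      _ ≤ I.n * I.d := Nat.mul_le_mul_right _ i.2
  have hQ : (geo I).Q = (geo I).D + (2 + 2 * (I.n * I.d)) + 1 := by rw [Geo.Q, geo_L]
  rw [Function.update_of_ne (by rw [hQ]; omega)]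
  exact relocated_A I i k

/-- `B` is in place for the `y` loop. [folklore] -/
theorem inputB_start (hn : 0 < I.n) :
    InputB (geo I) I (xData (geo I) I hn (Function.update (relocated (OV.encode I)) (geo I).Q (geo I).LX)
      (geo I).LX) := by
  intro j k
  have hjk : (j : ℕ) * I.d + k < I.n * I.d :=
    calc (j : ℕ) * I.d + k < j * I.d + I.d := by omega
      _ = (j + 1) * I.d := by ring
      _ ≤ I.n * I.d := Nat.mul_le_mul_right _ j.2
  have hQ : (geo I).Q = (geo I).D + (2 + 2 * (I.n * I.d)) + 1 := by rw [Geo.Q, geo_L]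
  unfold xData
  rw [if_neg (by rw [hQ]; omega), Function.update_of_ne (by rw [hQ]; omega)]
  exact relocated_B I j k

/-! ### The run -/

set_option maxHeartbeats 800000 in
/-- **The run of the reduction program.** For every oracle answering `LCS`, on `OV.encode I` the
program `prog` executes within `Ttot I` steps to a store whose read-out is `[1]` iff `I` has an
orthogonal pair (`[0]` otherwise) and whose query log is `[encodeBoolPair (ovX I, ovY I)]` (empty if
`n = 0`), provided the word size holds the bound `(geo I).BND`.
[cite: BringmannKunnemannFOCS2015, Thm. 3.3 (proof)] -/
theorem prog_exec (hB : (geo I).BND < 2 ^ W)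
    (hO : LCS.OracleAnswers O) :
    ∃ (st : Store) (t : ℕ), t ≤ Ttot I ∧ Exec W O prog ⟨initFun (OV.encode I), []⟩ st t ∧
      readOut st.mem = [if I.HasOrthogonalPair then 1 else 0] ∧
      st.queries = (if I.n = 0 then [] else [encodeBoolPair (ovX I, ovY I)]) := by
  classical
  have hlen : (OV.encode I).length = 2 + 2 * (I.n * I.d) := length_OV_encode I
  have hDdef : (geo I).D = (OV.encode I).length + 100 := rfl
  have hBND : 10 * ((geo I).D + (geo I).n + (geo I).d + (geo I).LX + (geo I).LY + (geo I).Q + (geo I).LEN +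
      (geo I).rho) + 1000 ≤ (geo I).BND := by unfold Geo.BND; omega
  simp only [(geo_nd I).1, (geo_nd I).2] at hBND
  have hW2 : 2 ≤ 2 ^ W := by omega
  -- the relocation
  have hx : ∀ v ∈ OV.encode I, v < 2 ^ W := fun v hv => by
    have := le_of_mem_OV_encode I hv
    have : max I.n (max I.d 1) ≤ I.n + I.d + 1 := max_le (by omega) (max_le (by omega) (by omega))
    omega
  have E1 := relocate_exec (w := W) (O := O) (x := OV.encode I) (by omega) hx (by omega) []
  -- chunk 1 of the set-up, from `merge (relocated x) (relocated x)`
  have hself : relocated (OV.encode I) = merge (relocated (OV.encode I)) (relocated (OV.encode I)) :=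
    (merge_self _).symm
  have hn_at : relocated (OV.encode I) ((geo I).D + 1) = (geo I).n := by
    rw [hDdef, relocated_base_add _ le_rfl (by omega)]; rfl
  have hd_at : relocated (OV.encode I) ((geo I).D + 2) = (geo I).d := by
    rw [hDdef, relocated_base_add _ (by omega) (by omega)]; rfl
  obtain ⟨m₁, t₁, ht₁, E2, R₁, hm₁, hC₁⟩ := setup₁_spec (O := O) (geo I) (R := relocated (OV.encode I))
    (H := relocated (OV.encode I)) (by simp [hDdef]) (by simp [hDdef]) (by omega) hn_at hd_at hB []
  rw [← hself] at E2
  have h10 : m₁ 10 = I.n := by rw [hm₁, merge_apply_of_lt (by decide)]; exact hC₁ 10 (by simp)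
  by_cases hn0 : I.n = 0
  · -- no vectors: output `[0]`
    have hno : ¬ I.HasOrthogonalPair := fun ⟨i, _, _⟩ => by have := i.isLt; omega
    refine ⟨⟨execOps W m₁ out0, []⟩, _, ?_, Exec.seq E1 (Exec.seq E2 (Exec.ifz_zero (by
      simp only [Operand.read, h10, hn0]) (Exec.block out0 m₁ []))), ?_, by simp [hn0]⟩
    · show 7 * (OV.encode I).length + (t₁ + (out0.length + 1)) ≤ Ttot I
      simp only [out0, List.length_cons, List.length_nil]
      unfold Ttot; omega
    · rw [if_neg hno]
      have e0 : execOps W m₁ out0 0 = 1 := by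
        simp (disch := first | omega | decide) only [out0, execOps_cons, execOps_nil, execOp, Operand.write,
          Operand.read, Function.update_self, BinOp.eval_add_of_lt]
      have e1 : execOps W m₁ out0 1 = 0 := by
        simp (disch := first | omega | decide) only [out0, execOps_cons, execOps_nil, execOp, Operand.write,
          Operand.read, Function.update_self, Function.update_of_ne, BinOp.eval_add_of_lt]
      simp [readOut, readSeg, e0, e1]
  · -- the main branch
    have hn : 0 < I.n := Nat.pos_of_ne_zero hn0
    have hn' : 1 ≤ (geo I).n := hn
    have hD : 100 ≤ (geo I).D := by rw [hDdef]; omega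
    have hL : 2 + 2 * ((geo I).n * (geo I).d) ≤ (geo I).L := by rw [geo_L]; exact le_rfl
    subst hm₁
    -- set-up
    obtain ⟨m₂, t₂, ht₂, E3, R₂, hm₂, hC₂, h3₂, h4₂⟩ := setupMain_spec (O := O) (geo I) (R := R₁)
      (H := relocated (OV.encode I)) hC₁ hD hn' hB []
    subst hm₂
    -- the `x` loop
    obtain ⟨m₃, t₃, ht₃, E4, R₃, hm₃, hC₃, h3₃, h4₃⟩ := loopX_spec (O := O) (geo I) I (geo_nd I) hC₂ hn
      (inputA_start I) h3₂ h4₂ hL hD hB []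
    subst hm₃
    -- the `y` loop
    obtain ⟨m₄, t₄, ht₄, E5, R₄, hm₄, hC₄, h3₄, h4₄⟩ := loopY_spec (O := O) (geo I) I (geo_nd I) hC₃ hn
      (inputB_start I hn) hL hD hB []
    subst hm₄
    -- the query
    have h72 : R₄ 72 = (geo I).Q := hC₄ 72 (by decide)
    have h73 : R₄ 73 = (geo I).LEN := hC₄ 73 (by decide)
    have h74 : R₄ 74 = (geo I).Q + (geo I).LEN := hC₄ 74 (by decide)
    have hQ100 : 100 ≤ (geo I).Q := by unfold Geo.Q; omega
    have E6 := Exec.query_dir (w := W) (O := O) (qa := 72) (ql := 73) (aa := 74) (by decide) (by decide)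
      (by decide) (S := R₄) (by rw [h72]; exact hQ100) (by rw [h74]; omega) (dataQ I hn) []
    rw [h72, h73, h74, List.nil_append, readSeg_dataQ I hn] at E6
    -- the oracle's answer
    have hans : O (encodeBoolPair (ovX I, ovY I)) = [lcsLength (ovX I) (ovY I)] := by
      have := hO (ovX I, ovY I)
      simpa [LCS, FGProblem.ofFun] using this
    have hlcs : lcsLength (ovX I) (ovY I) < 2 ^ W := by
      have := lcsLength_le_length_left (ovX I) (ovY I)
      rw [length_ovX_eq (geo I) I (geo_nd I) hn] at this
      omega
    rw [hans, List.map_cons, List.map_nil, Nat.mod_eq_of_lt hlcs] at E6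
    -- the read-out
    set H₅ := segWrite (dataQ I hn) ((geo I).Q + (geo I).LEN) [lcsLength (ovX I) (ovY I)] with hH₅
    have hval : H₅ ((geo I).Q + (geo I).LEN + 1) = lcsLength (ovX I) (ovY I) := by
      rw [hH₅]; unfold segWrite
      rw [if_neg (by omega), if_pos ⟨by omega, by simp⟩]
      simp
    have h70 : R₄ 70 = (geo I).LX := hC₄ 70 (by decide)
    have h71 : R₄ 71 = (geo I).LY := hC₄ 71 (by decide)
    have h80 : R₄ 80 = (geo I).rho := hC₄ 80 (by decide)
    have E7 := Exec.block post (W := W) (O := O) (merge R₄ H₅) [encodeBoolPair (ovX I, ovY I)]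
    have E8 : Exec W O main ⟨merge R₁ (relocated (OV.encode I)), []⟩
        ⟨execOps W (merge R₄ H₅) post, [encodeBoolPair (ovX I, ovY I)]⟩
        (t₂ + (t₃ + (t₄ + (1 + (post.length + 0))))) :=
      Exec.seq E3 (Exec.seq E4 (Exec.seq E5 (Exec.seq E6 (Exec.seq E7 (Exec.skip _)))))
    refine ⟨⟨execOps W (merge R₄ H₅) post, [encodeBoolPair (ovX I, ovY I)]⟩, _, ?_,
      Exec.seq E1 (Exec.seq E2 (Exec.ifz_ne (by simp only [Operand.read, h10]; exact hn0) E8)), ?_,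
      by simp [hn0]⟩
    · -- the time
      simp only [post, List.length_cons, List.length_nil]
      unfold Ttot; omega
    · -- the read-out is `[δ ≤ ρ]` = `[HasOrthogonalPair]`
      have e0 : execOps W (merge R₄ H₅) post 0 = 1 := by
        simp (disch := first | omega | decide) only [post, execOps_cons, execOps_nil, execOp, Operand.write,
          Operand.read, merge_apply_of_lt, merge_apply_of_le, update_merge_of_lt, Function.update_self,
          Function.update_of_ne, BinOp.eval_add_of_lt, BinOp.eval_lt, h74, h70, h71, h80, hval]
      have hlcsLX : lcsLength (ovX I) (ovY I) ≤ (geo I).LX := by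
        have := lcsLength_le_length_left (ovX I) (ovY I)
        rwa [length_ovX_eq (geo I) I (geo_nd I) hn] at this
      have e1 : execOps W (merge R₄ H₅) post 1 =
          if (geo I).LX + (geo I).LY < (geo I).rho + lcsLength (ovX I) (ovY I) + lcsLength (ovX I) (ovY I) + 1
          then 1 else 0 := by
        simp (disch := first | omega | decide) only [post, execOps_cons, execOps_nil, execOp, Operand.write,
          Operand.read, merge_apply_of_lt, merge_apply_of_le, update_merge_of_lt, Function.update_self,
          Function.update_of_ne, BinOp.eval_add_of_lt, BinOp.eval_lt, h74, h70, h71, h80, hval, Nat.add_zero]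
      have hflag : ((geo I).LX + (geo I).LY <
          (geo I).rho + lcsLength (ovX I) (ovY I) + lcsLength (ovX I) (ovY I) + 1) ↔ I.HasOrthogonalPair := by
        rw [← dLCS_ovX_ovY_le_iff I hn, ← rho_eq, ← length_ovX_eq (geo I) I (geo_nd I) hn,
          ← length_ovY_eq (geo I) I (geo_nd I)]
        have := dLCS_add (ovX I) (ovY I)
        omega
      simp only [readOut, readSeg, e0, List.range_one, List.map_cons, List.map_nil, Nat.add_zero, e1]
      by_cases hp : I.HasOrthogonalPair
      · rw [if_pos (hflag.2 hp), if_pos hp]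
      · rw [if_neg (fun h => hp (hflag.1 h)), if_neg hp]
end run

end Literature.Computability.FineGrained.LCSRed
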